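import Summits.CriticalPhenomena.SAWScalingLimit.Theorems.SAWDevelopingMapObservableToSLECanonicalTransferGreedy
import HarnessLib

/-!
# Crux `SAWDevelopingMap.ObservableToSLE` (stmt-CriticalPhenomena-10472), line
`floor-ratio-restriction-bootstrap`, stub `stub_canonicalTransfer`: lattice paths towards a vertex
(lattice topology for the inner admissible discretisation (M1))

Landing target:
`Summits/CriticalPhenomena/SAWScalingLimit/Theorems/SAWDevelopingMapObservableToSLECanonicalTransferLatticePaths.lean`
(`--supports stmt-CriticalPhenomena-10472`).  Sequel of `…CanonicalTransferGreedy.lean`.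

Greedy descent (`exists_walk_normSq_le`) ends within one edge length `1/√3` of the target point.
When the target is itself a lattice vertex this last gap is an edge:

* `eq_or_adj_of_normSq_le` — two honeycomb vertices at (centre) distance `≤ 1/√3` coincide or are
  adjacent (the integer quadratic form `a² + ab + b²` of the triangular lattice on the three
  sublattice cosets);
* `exists_walk_dist_le_dist` = registered sub-goal `stub_canonicalTransfer_latticePath` — **for any
  two vertices `v`, `w` there is a honeycomb walk from `v` to `w` all of whose vertices are at
  distance `≤ dist (c_v) (c_w)` from `c_w`** (in particular the honeycomb lattice is connected,
  `hexGraph_connected`, and lattice balls around a vertex are connected through themselves).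
-/

noncomputable section

open Set Metric
open Literature.Probability.LatticeModels (HexVertex hexGraph hexCenter Site
  hexGraph_adj_iff_of_snd_eq_zero_holds hexGraph_adj_iff_of_snd_eq_one normSq_add_mul_triZeta)
open Literature.Probability.RandomPlanarGeometry
open Literature.Probability.RandomPlanarGeometry.SAW

namespace Summit.CriticalPhenomena.SAWScalingLimit.Theorems.ObservableToSLE.FloorRatio

/-! ### Vertices within one edge length -/

/-- Integer solutions of `d₀² + d₀ d₁ + d₁² ≤ d₀ + d₁`: `(0,0)`, `(1,0)`, `(0,1)`. [folklore] -/
private theorem int_sol_shift {d₀ d₁ : ℤ} (h : d₀ ^ 2 + d₀ * d₁ + d₁ ^ 2 - d₀ - d₁ ≤ 0) :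
    (d₀ = 0 ∧ d₁ = 0) ∨ (d₀ = 1 ∧ d₁ = 0) ∨ (d₀ = 0 ∧ d₁ = 1) := by
  have h1 : 0 ≤ d₁ ∧ d₁ ≤ 1 := by
    constructor <;> nlinarith [sq_nonneg (2 * d₀ + d₁ - 1), sq_nonneg (3 * d₁ + 1), sq_nonneg (d₁ - 1)]
  have h0 : 0 ≤ d₀ ∧ d₀ ≤ 1 := by
    constructor <;> nlinarith [sq_nonneg (2 * d₁ + d₀ - 1), sq_nonneg (3 * d₀ + 1), sq_nonneg (d₀ - 1)]
  obtain ⟨h1a, h1b⟩ := h1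
  obtain ⟨h0a, h0b⟩ := h0
  interval_cases d₀ <;> interval_cases d₁ <;> simp_all

/-- Integer solutions of `d₀² + d₀ d₁ + d₁² ≤ 1/3`: only `(0,0)`. [folklore] -/
private theorem int_sol_zero {d₀ d₁ : ℤ} (h : 3 * (d₀ ^ 2 + d₀ * d₁ + d₁ ^ 2) ≤ 1) :
    d₀ = 0 ∧ d₁ = 0 := by
  have h1 : -1 < d₁ ∧ d₁ < 1 := by
    constructor <;> nlinarith [sq_nonneg (2 * d₀ + d₁), sq_nonneg d₁]
  have h0 : -1 < d₀ ∧ d₀ < 1 := by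
    constructor <;> nlinarith [sq_nonneg (2 * d₁ + d₀), sq_nonneg d₀]
  omega

/-- **Two honeycomb vertices at distance `≤ 1/√3` coincide or are adjacent.** [folklore] -/
theorem eq_or_adj_of_normSq_le {w v : HexVertex}
    (h : Complex.normSq (hexCenter w - hexCenter v) ≤ 1 / 3) : w = v ∨ hexGraph.Adj w v := by
  obtain ⟨x, i⟩ := w
  obtain ⟨y, j⟩ := v
  rw [hexCenter_sub_hexCenter, normSq_add_mul_triZeta] at h
  have hxy : ∀ {a b : ℤ}, x 0 - y 0 = a → x 1 - y 1 = b →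
      x = y + (Pi.single 0 a + Pi.single 1 b) := by
    intro a b ha hb
    funext k; fin_cases k
    · simp only [Fin.zero_eta, Pi.add_apply, Pi.single_eq_same, ne_eq, zero_ne_one,
        not_false_eq_true, Pi.single_eq_of_ne]; omega
    · simp only [Fin.mk_one, Pi.add_apply, ne_eq, one_ne_zero, not_false_eq_true,
        Pi.single_eq_of_ne, Pi.single_eq_same]; omega
  fin_cases i <;> fin_cases j
  · -- same sublattice (up/up)
    simp only [Nat.cast_zero, sub_zero, zero_div, add_zero] at h
    have h' : 3 * ((x 0 - y 0) ^ 2 + (x 0 - y 0) * (x 1 - y 1) + (x 1 - y 1) ^ 2) ≤ 1 := by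
      have : (3 : ℝ) * (((x 0 - y 0 : ℤ) : ℝ) ^ 2 + ((x 0 - y 0 : ℤ) : ℝ) * ((x 1 - y 1 : ℤ) : ℝ) +
          ((x 1 - y 1 : ℤ) : ℝ) ^ 2) ≤ 1 := by linarith
      exact_mod_cast this
    obtain ⟨h0, h1⟩ := int_sol_zero h'
    left
    have := hxy h0 h1
    simp only [Pi.single_zero, add_zero] at this
    rw [this]
  · -- up minus down
    simp only [Nat.cast_zero, Nat.cast_one, zero_sub] at h
    have h' : (x 0 - y 0) ^ 2 + (x 0 - y 0) * (x 1 - y 1) + (x 1 - y 1) ^ 2 - (x 0 - y 0) -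
        (x 1 - y 1) ≤ 0 := by
      have : ((x 0 - y 0 : ℤ) : ℝ) ^ 2 + ((x 0 - y 0 : ℤ) : ℝ) * ((x 1 - y 1 : ℤ) : ℝ) +
          ((x 1 - y 1 : ℤ) : ℝ) ^ 2 - ((x 0 - y 0 : ℤ) : ℝ) - ((x 1 - y 1 : ℤ) : ℝ) ≤ 0 := by
        nlinarith
      exact_mod_cast this
    refine Or.inr ((hexGraph_adj_iff_of_snd_eq_zero_holds x y).2 ?_)
    rcases int_sol_shift h' with ⟨h0, h1⟩ | ⟨h0, h1⟩ | ⟨h0, h1⟩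
    · have := hxy h0 h1
      simp only [Pi.single_zero, add_zero] at this
      exact Or.inl this.symm
    · have := hxy h0 h1
      simp only [Pi.single_zero, add_zero] at this
      exact Or.inr (Or.inl (by rw [this]; abel))
    · have := hxy h0 h1
      simp only [Pi.single_zero, zero_add] at this
      exact Or.inr (Or.inr (by rw [this]; abel))
  · -- down minus up
    simp only [Nat.cast_zero, Nat.cast_one, sub_zero] at h
    have h' : (-(x 0 - y 0)) ^ 2 + (-(x 0 - y 0)) * (-(x 1 - y 1)) + (-(x 1 - y 1)) ^ 2 -
        (-(x 0 - y 0)) - (-(x 1 - y 1)) ≤ 0 := by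
      have : ((x 0 - y 0 : ℤ) : ℝ) ^ 2 + ((x 0 - y 0 : ℤ) : ℝ) * ((x 1 - y 1 : ℤ) : ℝ) +
          ((x 1 - y 1 : ℤ) : ℝ) ^ 2 + ((x 0 - y 0 : ℤ) : ℝ) + ((x 1 - y 1 : ℤ) : ℝ) ≤ 0 := by
        nlinarith
      have h2 : (x 0 - y 0) ^ 2 + (x 0 - y 0) * (x 1 - y 1) + (x 1 - y 1) ^ 2 + (x 0 - y 0) +
          (x 1 - y 1) ≤ 0 := by exact_mod_cast this
      nlinarith [h2]
    refine Or.inr ((hexGraph_adj_iff_of_snd_eq_one x y).2 ?_)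
    rcases int_sol_shift h' with ⟨h0, h1⟩ | ⟨h0, h1⟩ | ⟨h0, h1⟩
    · have := hxy (a := 0) (b := 0) (by omega) (by omega)
      simp only [Pi.single_zero, add_zero] at this
      exact Or.inl this.symm
    · have := hxy (a := -1) (b := 0) (by omega) (by omega)
      simp only [Pi.single_zero, add_zero] at this
      refine Or.inr (Or.inl ?_)
      rw [this, add_assoc, ← Pi.single_add]; simp
    · have := hxy (a := 0) (b := -1) (by omega) (by omega)
      simp only [Pi.single_zero, zero_add] at this
      refine Or.inr (Or.inr ?_)
      rw [this, add_assoc, ← Pi.single_add]; simp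
  · -- same sublattice (down/down)
    simp only [Nat.cast_one, sub_self, zero_div, add_zero] at h
    have h' : 3 * ((x 0 - y 0) ^ 2 + (x 0 - y 0) * (x 1 - y 1) + (x 1 - y 1) ^ 2) ≤ 1 := by
      have : (3 : ℝ) * (((x 0 - y 0 : ℤ) : ℝ) ^ 2 + ((x 0 - y 0 : ℤ) : ℝ) * ((x 1 - y 1 : ℤ) : ℝ) +
          ((x 1 - y 1 : ℤ) : ℝ) ^ 2) ≤ 1 := by linarith
      exact_mod_cast this
    obtain ⟨h0, h1⟩ := int_sol_zero h'
    left
    have := hxy h0 h1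
    simp only [Pi.single_zero, add_zero] at this
    rw [this]

/-! ### Walks towards a vertex -/

/-- **A walk towards a vertex inside the disc it spans** (named form of the registered sub-goal
`stub_canonicalTransfer_latticePath`): for any two honeycomb vertices `v`, `w` there is a walk from
`v` to `w` all of whose vertices `u` satisfy `dist (c_u) (c_w) ≤ dist (c_v) (c_w)` (greedy descent
towards `c_w`, closed by the last edge). [folklore] -/
theorem exists_walk_dist_le_dist (v w : HexVertex) :
    ∃ p : hexGraph.Walk v w, ∀ u ∈ p.support,
      dist (hexCenter u) (hexCenter w) ≤ dist (hexCenter v) (hexCenter w) := by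
  obtain ⟨z, p, hz, hp⟩ := exists_walk_normSq_le v (hexCenter w)
  have hp' : ∀ u ∈ p.support, dist (hexCenter u) (hexCenter w) ≤ dist (hexCenter v) (hexCenter w) := by
    intro u hu
    have h := hp u hu
    rw [Complex.normSq_eq_norm_sq, Complex.normSq_eq_norm_sq,
      pow_le_pow_iff_left₀ (norm_nonneg _) (norm_nonneg _) two_ne_zero] at h
    rwa [dist_comm, dist_eq_norm, dist_comm, dist_eq_norm]
  have hz' : Complex.normSq (hexCenter z - hexCenter w) ≤ 1 / 3 := by
    rwa [← Complex.normSq_neg, neg_sub]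
  rcases eq_or_adj_of_normSq_le hz' with rfl | hadj
  · exact ⟨p, hp'⟩
  · refine ⟨p.concat hadj, fun u hu => ?_⟩
    rw [SimpleGraph.Walk.support_concat, List.mem_append, List.mem_singleton] at hu
    rcases hu with hu | rfl
    · exact hp' u hu
    · rw [dist_self]; exact dist_nonneg

/-- **The honeycomb lattice is connected.** [folklore] -/
theorem hexGraph_connected : hexGraph.Connected :=
  ⟨fun v w => ⟨(exists_walk_dist_le_dist v w).choose⟩⟩

/-- **Registered sub-goal `stub_canonicalTransfer_latticePath`** (crux item stmt-CriticalPhenomena-10472,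
line `floor-ratio-restriction-bootstrap`, stub `stub_canonicalTransfer`): walks towards a vertex
inside the disc they span, registry form of `exists_walk_dist_le_dist`. [folklore] -/
theorem stub_canonicalTransfer_latticePath :
    ∀ (v w : HexVertex), ∃ p : hexGraph.Walk v w, ∀ u ∈ p.support,
      dist (hexCenter u) (hexCenter w) ≤ dist (hexCenter v) (hexCenter w) :=
  exists_walk_dist_le_dist

end Summit.CriticalPhenomena.SAWScalingLimit.Theorems.ObservableToSLE.FloorRatio

end
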